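import Literature.NumberTheory.Transcendental.AyoubPeriodSeriesPiAlgebraic
import Mathlib.RingTheory.MvPowerSeries.Rename
import Mathlib.RingTheory.PowerSeries.WellKnown
import Mathlib.Analysis.SpecialFunctions.Complex.LogBounds
import Mathlib.Analysis.Complex.Trigonometric
import HarnessLib

/-!
# Ayoub's `𝒫†(k, σ) = 𝒫†,eff(k, σ)[(2πi)⁻¹]`: the powers `(2πi)^N` are effective periods in fresh variables

Proofs only (no definition of a new notion, no named fact), on top of
`Literature/NumberTheory/Transcendental/AyoubPeriodSeries.lean` and its proof files
(`…Kernel`, `…Proofs`, `…PiAlgebraic`).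

Source: J. Ayoub, *La version relative de la conjecture des périodes de Kontsevich–Zagier
revisitée* (`AyoubRelKZRevisited`), §1.1 and Notation 1.9 (iii), p. 4: "Remarquons que
`2πi ∈ 𝒫^{eff}(k, σ)`. On pose `𝒫(k, σ) = 𝒫^{eff}(k, σ)[(2πi)⁻¹]` et
`𝒫†(k, σ) = 𝒫†,eff(k, σ)[(2πi)⁻¹]`."

## Why this file exists

The named fact `ayoub_integration_injective_localized` (Théorème 1.11) renders the injectivity of
`∫ : 𝒫†,eff(k, σ)[(2πi)⁻¹] → ℂ((ϖ))` elementarily: `∫ F = 0 ⟹ ∃ N, ∃ g ∈ 𝒪_{k-alg}(𝔻̄^∞)` in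
variables disjoint from those of `F` with `∫ g = (2πi)^N` and `g • F ∈ ⟨(a), (b)⟩_k`; here
`[g • F] = (∫ g) · [F]` is the `𝒫^{eff}(k, σ)`-module structure of Notation 1.9 (ii).  For this
unpacking to be IMPLIED BY (not merely to imply) the printed theorem one needs, for every `N` and
every finite set `S` of variables, an element `g ∈ 𝒪_{k-alg}(𝔻̄^∞)` avoiding `S` with
`∫ g = (2πi)^N` — i.e. Notation 1.9 (iii) "`2πi ∈ 𝒫^{eff}(k, σ)`" together with the product
structure of `𝒫^{eff}(k, σ)` in disjoint variables.  This file PROVES that, for every field `k`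
(char. `0` is not even needed) and every `σ : k →+* ℂ`:

* `perGerm m = 1/(α - z_m)` with `α = (1 - e^{iπ/4})⁻¹` (an algebraic number of modulus
  `1/(2 sin(π/8)) > 1`): an element of `𝒪_{k-alg}(𝔻̄^∞)` in the single variable `z_m`
  (`perGerm_mem_Oan`), with `∫₀¹ dz/(α - z) = -log(1 - α⁻¹) = -log(e^{iπ/4}) = -iπ/4`
  (`intC_perGerm`; Mercator series `Complex.hasSum_taylorSeries_neg_log`);
* `𝒪_{k-alg}(𝔻̄^∞)` is closed under products (`mul_mem_Oan`: Cauchy product for the polyradius,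
  Mathlib's `IsAlgebraic.mul` over the domain `k[z]`);
* `perGermPow m N = ∏_{j<N} (-8) • perGerm (m + j) ∈ 𝒪_{k-alg}(𝔻̄^∞)` involves only
  `z_m, …, z_{m+N-1}` and `∫ perGermPow m N = (2πi)^N` (`intC_perGermPow`, Fubini in disjoint
  variables = `intC_mul_of_disjoint` of the Kernel file);
* `exists_mem_Oan_intC_eq_two_pi_I_pow`: for all `N`, `S : Finset ℕ` there is `g ∈ 𝒪_{k-alg}(𝔻̄^∞)`
  avoiding the variables in `S` with `∫ g = (2πi)^N`;
* `two_pi_I_mem_effPeriods`, `two_pi_I_pow_mem_effPeriods`: **`(2πi)^N ∈ 𝒫^{eff}(k, σ)`**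
  (Notation 1.9 (iii)).

The companion statement "every `F ∈ 𝒪†_{k-alg}(𝔻̄^∞)` involves finitely many variables
uniformly in the `ϖ`-degree" (§1.1, p. 2: "la condition d'algébricité entraîne en particulier que
les coefficients `f_r` ne dépendent que d'un nombre fini des `z_i` indépendemment de `r`"), which
then yields a `g` disjoint from any given `F` with `∫ g = (2πi)^N`, is treated separately (it
needs `char k = 0`).

The auxiliary `def`s of this file (`zeta8`, `wConst`, `alphaUnit`, `axisEmb`, `perGerm`,
`perGermPow`) are explicit witnesses, not new notions.
-/

noncomputable section

open Finsupp MvPowerSeries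

namespace Literature.NumberTheory.Transcendental.AyoubRel

/-! ### The constants `ζ = e^{iπ/4}`, `w = 1 - ζ`, `α = w⁻¹` -/

/-- `ζ₈ = e^{iπ/4}`. [folklore] -/
def zeta8 : ℂ := Complex.exp (((Real.pi / 4 : ℝ) : ℂ) * Complex.I)

/-- `w = 1 - e^{iπ/4}`, so that `1 - w = e^{iπ/4}` has principal logarithm `iπ/4` and
`‖w‖ = 2 sin(π/8) < 1`. [folklore] -/
def wConst : ℂ := 1 - zeta8

/-- `ζ₈⁴ = e^{iπ} = -1`. [folklore] -/
theorem zeta8_pow_four : zeta8 ^ 4 = -1 := by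
  rw [zeta8, ← Complex.exp_nat_mul]
  have : ((4 : ℕ) : ℂ) * (((Real.pi / 4 : ℝ) : ℂ) * Complex.I) = Real.pi * Complex.I := by
    push_cast; ring
  rw [this, Complex.exp_pi_mul_I]

/-- `‖1 - e^{iπ/4}‖ = 2 sin(π/8)`. [folklore] -/
theorem norm_wConst : ‖wConst‖ = 2 * Real.sin (Real.pi / 8) := by
  rw [wConst, zeta8, norm_sub_rev, mul_comm, Complex.norm_exp_I_mul_ofReal_sub_one,
    show Real.pi / 4 / 2 = Real.pi / 8 by ring, Real.norm_eq_abs, abs_of_pos]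
  exact mul_pos two_pos (Real.sin_pos_of_pos_of_lt_pi (by positivity) (by linarith [Real.pi_pos]))

/-- `0 < ‖w‖`. [folklore] -/
theorem norm_wConst_pos : 0 < ‖wConst‖ := by
  rw [norm_wConst]
  exact mul_pos two_pos (Real.sin_pos_of_pos_of_lt_pi (by positivity) (by linarith [Real.pi_pos]))

/-- `‖w‖ = 2 sin(π/8) < 2 sin(π/6) = 1`. [folklore] -/
theorem norm_wConst_lt_one : ‖wConst‖ < 1 := by
  rw [norm_wConst]
  have h : Real.sin (Real.pi / 8) < Real.sin (Real.pi / 6) :=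
    Real.sin_lt_sin_of_lt_of_le_pi_div_two (by linarith [Real.pi_pos]) (by linarith [Real.pi_pos])
      (by linarith [Real.pi_pos])
  rw [Real.sin_pi_div_six] at h
  linarith

/-- `w ≠ 0`. [folklore] -/
theorem wConst_ne_zero : wConst ≠ 0 := norm_pos_iff.mp norm_wConst_pos

/-- `log (1 - w) = log e^{iπ/4} = iπ/4` (principal branch, `π/4 ∈ (-π, π]`). [folklore] -/
theorem log_one_sub_wConst : Complex.log (1 - wConst) = ((Real.pi / 4 : ℝ) : ℂ) * Complex.I := by
  rw [wConst, sub_sub_cancel, zeta8]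
  apply Complex.log_exp
  · simp only [Complex.mul_im, Complex.ofReal_re, Complex.I_im, Complex.ofReal_im, Complex.I_re,
      mul_zero, mul_one, add_zero]
    linarith [Real.pi_pos]
  · simp only [Complex.mul_im, Complex.ofReal_re, Complex.I_im, Complex.ofReal_im, Complex.I_re,
      mul_zero, mul_one, add_zero]
    linarith [Real.pi_pos]

/-- `α = w⁻¹ = 1/(1 - e^{iπ/4})`, as a unit of `ℂ`. [folklore] -/
def alphaUnit : ℂˣ := (Units.mk0 wConst wConst_ne_zero)⁻¹

/-- `α⁻¹ = w`. [folklore] -/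
@[simp] theorem val_inv_alphaUnit : ((alphaUnit⁻¹ : ℂˣ) : ℂ) = wConst := by
  simp [alphaUnit]

/-- `α = w⁻¹`. [folklore] -/
theorem val_alphaUnit : ((alphaUnit : ℂˣ) : ℂ) = wConst⁻¹ := by
  simp [alphaUnit]

/-! ### The one-variable germ `1/(α - z_m)` -/

/-- The axis embedding `Unit ↪ ℕ`, `() ↦ m` (to rename the variable of a one-variable power
series into `z_m`). [folklore] -/
def axisEmb (m : ℕ) : Unit ↪ ℕ := ⟨fun _ => m, fun a b _ => Subsingleton.elim a b⟩

/-- `axisEmb m` is constant `m`. [folklore] -/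
@[simp] theorem axisEmb_apply (m : ℕ) (u : Unit) : axisEmb m u = m := rfl

/-- **`perGerm m = 1/(α - z_m) = Σ_n α^{-(n+1)} z_m^n ∈ ℂ[[z]]`**, the power series of
`1/(u - x)` (`PowerSeries.invUnitsSub`) in the variable `z_m`. [folklore] -/
def perGerm (m : ℕ) : CSeries :=
  MvPowerSeries.rename (axisEmb m) (PowerSeries.invUnitsSub alphaUnit : MvPowerSeries Unit ℂ)

/-- Coefficient of `z_m^n` in `1/(α - z_m)`: `α^{-(n+1)} = w^{n+1}`. [folklore] -/
theorem coeff_perGerm_single (m n : ℕ) : coeff (single m n) (perGerm m) = wConst ^ (n + 1) := by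
  have h := coeff_embDomain_rename (R := ℂ) (axisEmb m)
    (PowerSeries.invUnitsSub alphaUnit : MvPowerSeries Unit ℂ) (single () n)
  rw [embDomain_single, axisEmb_apply] at h
  rw [perGerm, h]
  change PowerSeries.coeff n (PowerSeries.invUnitsSub alphaUnit) = _
  rw [PowerSeries.coeff_invUnitsSub, one_divp, ← inv_pow, Units.val_pow_eq_pow_val,
    val_inv_alphaUnit]

/-- Off the `z_m`-axis the coefficients of `1/(α - z_m)` vanish. [folklore] -/
theorem coeff_perGerm_of_ne {m : ℕ} {x : ℕ →₀ ℕ} (hx : ∀ n, x ≠ single m n) :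
    coeff x (perGerm m) = 0 := by
  rw [perGerm]
  apply coeff_rename_eq_zero
  rintro ⟨y, hy⟩
  apply hx (y ())
  rw [← hy]
  conv_lhs => rw [unique_single y]
  rw [mapDomain_single]
  rfl

/-- `1/(α - z_m)` depends only on `z_0, …, z_m`. [folklore] -/
theorem dependsOnlyOnLT_perGerm (m : ℕ) : DependsOnlyOnLT (perGerm m) (m + 1) := by
  rintro a ⟨i, hi, hai⟩
  refine coeff_perGerm_of_ne fun n hn => hai ?_
  rw [hn, single_apply, if_neg]
  omega

/-- `1/(α - z_m)` involves only the variable `z_m`. [folklore] -/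
theorem eq_of_usesVar_perGerm {m i : ℕ} (h : UsesVar (perGerm m) i) : i = m := by
  obtain ⟨a, hai, hne⟩ := h
  by_contra him
  refine hne (coeff_perGerm_of_ne fun n hn => hai ?_)
  rw [hn, single_apply, if_neg (Ne.symm him)]

/-- `1/(α - z_m)` has radius of convergence `‖α‖ = 1/‖w‖ > 1`: with `r = 2/(1 + ‖w‖) > 1`,
`Σ_n ‖w‖^{n+1} r^n` is a convergent geometric series. [folklore] -/
theorem hasPolyradiusGtOne_perGerm (m : ℕ) : HasPolyradiusGtOne (perGerm m) := by
  set ρ : ℝ := ‖wConst‖ with hρdef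
  have hρ0 : 0 < ρ := norm_wConst_pos
  have hρ1 : ρ < 1 := norm_wConst_lt_one
  set r : ℝ := 2 / (1 + ρ) with hr
  have hr1 : 1 < r := by
    rw [hr, lt_div_iff₀ (by linarith)]
    linarith
  have hρr : ρ * r < 1 := by
    rw [hr, mul_div_assoc', div_lt_one (by linarith)]
    linarith
  have hρr0 : 0 ≤ ρ * r := by positivity
  refine ⟨r, hr1, ?_⟩
  have key : Summable ((fun a : ℕ →₀ ℕ => ‖coeff a (perGerm m)‖ * r ^ degree a) ∘
      (single m : ℕ → ℕ →₀ ℕ)) := by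
    have e : ((fun a : ℕ →₀ ℕ => ‖coeff a (perGerm m)‖ * r ^ degree a) ∘
        (single m : ℕ → ℕ →₀ ℕ)) = fun n => ρ * (ρ * r) ^ n := by
      funext n
      simp only [Function.comp_apply]
      rw [coeff_perGerm_single, degree_single, norm_pow, pow_succ, mul_pow]
      ring
    rw [e]
    exact (summable_geometric_of_lt_one hρr0 hρr).mul_left ρ
  refine (Function.Injective.summable_iff (single_injective m) ?_).mp key
  intro x hx
  rw [coeff_perGerm_of_ne, norm_zero, zero_mul]
  intro n hn
  exact hx ⟨n, hn.symm⟩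

/-- Renaming `PowerSeries.C c` along `() ↦ m` gives the constant `c`. [folklore] -/
theorem rename_axisEmb_C (m : ℕ) (c : ℂ) :
    MvPowerSeries.rename (axisEmb m) (MvPowerSeries.C c : MvPowerSeries Unit ℂ) = (C c : CSeries) :=
  rename_C _ c

/-- Renaming `PowerSeries.X` along `() ↦ m` gives `z_m`. [folklore] -/
theorem rename_axisEmb_X (m : ℕ) :
    MvPowerSeries.rename (axisEmb m) (MvPowerSeries.X () : MvPowerSeries Unit ℂ) = (X m : CSeries) :=
  rename_X _ ()

/-- **`(1/(α - z_m)) · (α - z_m) = 1`** (`PowerSeries.invUnitsSub_mul_sub`, renamed). [folklore] -/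
theorem perGerm_mul_C_sub_X (m : ℕ) :
    perGerm m * (C ((alphaUnit : ℂˣ) : ℂ) - X m) = 1 := by
  have h : (PowerSeries.invUnitsSub alphaUnit : MvPowerSeries Unit ℂ) *
      (MvPowerSeries.C ((alphaUnit : ℂˣ) : ℂ) - MvPowerSeries.X ()) = 1 :=
    PowerSeries.invUnitsSub_mul_sub alphaUnit
  have h' := congrArg (MvPowerSeries.rename (R := ℂ) (axisEmb m)) h
  rw [map_mul, map_sub, map_one, rename_axisEmb_C, rename_axisEmb_X] at h'
  exact h'

section Germ

variable {k : Type} [Field k] (σ : k →+* ℂ)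

/-- The variables `z_i` are algebraic over `k(z)` (roots of `Y - z_i`). [folklore] -/
theorem isAlgebraicOverRatFunc_X (i : ℕ) : IsAlgebraicOverRatFunc σ (X i : CSeries) :=
  ⟨Polynomial.X - Polynomial.C (MvPolynomial.X i), Polynomial.X_sub_C_ne_zero _, by
    simp [polyToCSeries, MvPolynomial.coe_X]⟩

/-- `α = 1/(1 - e^{iπ/4})` is algebraic over (the prime field of) `k`: `ζ₈` is a root of
`X⁴ + 1`, and algebraic numbers form a field. [folklore] -/
theorem algebraic_alphaUnit :
    ∃ p : Polynomial k, p ≠ 0 ∧ Polynomial.eval₂ σ ((alphaUnit : ℂˣ) : ℂ) p = 0 := by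
  letI : Algebra k ℂ := σ.toAlgebra
  change IsAlgebraic k ((alphaUnit : ℂˣ) : ℂ)
  have hζ : IsAlgebraic k zeta8 := by
    refine IsIntegral.isAlgebraic ⟨Polynomial.X ^ 4 + Polynomial.C 1, ?_, ?_⟩
    · exact Polynomial.monic_X_pow_add_C 1 (by norm_num)
    · simp [Polynomial.eval₂_add, Polynomial.eval₂_X_pow, zeta8_pow_four]
  have hw : IsAlgebraic k wConst := by
    rw [wConst, sub_eq_add_neg]
    exact isAlgebraic_one.add hζ.neg
  rw [val_alphaUnit]
  exact hw.inv

/-- `-8 ∈ ℤ ⊆ k` is algebraic over `k` (root of `X + 8`). [folklore] -/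
theorem algebraic_neg_eight :
    ∃ p : Polynomial k, p ≠ 0 ∧ Polynomial.eval₂ σ (-8 : ℂ) p = 0 :=
  ⟨Polynomial.X - Polynomial.C (-8), Polynomial.X_sub_C_ne_zero _, by
    rw [Polynomial.eval₂_sub, Polynomial.eval₂_X, Polynomial.eval₂_C, map_neg, map_ofNat,
      sub_self]⟩

/-- **`1/(α - z_m)` is algebraic over `k(z)`**: it is the inverse of the unit `α - z_m` of
`ℂ[[z]]`, which is algebraic over `k[z]` (Mathlib's `IsAlgebraic.invOf`). [folklore] -/
theorem isAlgebraicOverRatFunc_perGerm (m : ℕ) : IsAlgebraicOverRatFunc σ (perGerm m) := by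
  letI : Algebra (MvPolynomial ℕ k) CSeries := (polyToCSeries σ).toAlgebra
  have hu : IsAlgebraicOverRatFunc σ (C ((alphaUnit : ℂˣ) : ℂ) - X m : CSeries) := by
    rw [sub_eq_add_neg]
    exact (isAlgebraicOverRatFunc_C σ (algebraic_alphaUnit σ)).add σ
      ((isAlgebraicOverRatFunc_X σ m).neg σ)
  letI : Invertible (C ((alphaUnit : ℂˣ) : ℂ) - X m : CSeries) :=
    ⟨perGerm m, perGerm_mul_C_sub_X m, by rw [mul_comm]; exact perGerm_mul_C_sub_X m⟩
  exact ((isAlgebraicOverRatFunc_iff_isAlgebraic σ _).mp hu).invOf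

/-- **`1/(α - z_m) ∈ 𝒪_{k-alg}(𝔻̄^∞)`** for every `k`, `σ`. [cite: AyoubRelKZRevisited, §1.1] -/
theorem perGerm_mem_Oan (m : ℕ) : perGerm m ∈ Oan σ :=
  ⟨⟨m + 1, dependsOnlyOnLT_perGerm m⟩, hasPolyradiusGtOne_perGerm m,
    isAlgebraicOverRatFunc_perGerm σ m⟩

end Germ

/-- `∫_{[0,1]} z_m^n = (n + 1)⁻¹`. [folklore] -/
theorem intWeight_single (m n : ℕ) :
    ∏ j ∈ (single m n).support, (((single m n) j : ℂ) + 1)⁻¹ = ((n : ℂ) + 1)⁻¹ := by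
  rcases Nat.eq_zero_or_pos n with rfl | hn
  · simp
  · rw [support_single _ hn.ne', Finset.prod_singleton, single_eq_same]

/-- **`∫₀¹ dz/(α - z) = Σ_{n ≥ 0} w^{n+1}/(n+1) = -log(1 - w) = -iπ/4`** (Mercator series at
`w = 1 - e^{iπ/4}`, `‖w‖ < 1`). [folklore] -/
theorem intC_perGerm (m : ℕ) : intC (perGerm m) = -((((Real.pi / 4 : ℝ) : ℂ)) * Complex.I) := by
  have h1 : HasSum (fun n : ℕ => wConst ^ (n + 1) * ((n : ℂ) + 1)⁻¹) (-Complex.log (1 - wConst)) := by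
    have h := (hasSum_nat_add_iff' 1).mpr (Complex.hasSum_taylorSeries_neg_log norm_wConst_lt_one)
    simp only [Finset.range_one, Finset.sum_singleton, pow_zero, Nat.cast_zero, div_zero,
      sub_zero] at h
    simp only [Nat.cast_add, Nat.cast_one, div_eq_mul_inv] at h
    exact h
  rw [log_one_sub_wConst] at h1
  rw [intC, ← h1.tsum_eq]
  have h2 := Function.Injective.tsum_eq (single_injective m)
    (f := fun a : ℕ →₀ ℕ => coeff a (perGerm m) * ∏ j ∈ a.support, ((a j : ℂ) + 1)⁻¹) (fun a ha => by
      by_contra hra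
      apply ha
      change coeff a (perGerm m) * ∏ j ∈ a.support, ((a j : ℂ) + 1)⁻¹ = 0
      rw [coeff_perGerm_of_ne (fun n hn => hra ⟨n, hn.symm⟩), zero_mul])
  rw [← h2]
  refine tsum_congr fun n => ?_
  rw [coeff_perGerm_single, intWeight_single]

/-! ### `𝒪_{k-alg}(𝔻̄^∞)` is closed under products -/

/-- Products respect "depends only on `z_0, …`". [folklore] -/
theorem DependsOnlyOnLT.mul {F G : CSeries} {m n : ℕ} (hF : DependsOnlyOnLT F m)
    (hG : DependsOnlyOnLT G n) : DependsOnlyOnLT (F * G) (max m n) := by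
  rintro a ⟨i, hi, hai⟩
  rw [coeff_mul]
  refine Finset.sum_eq_zero fun p hp => ?_
  rw [Finset.HasAntidiagonal.mem_antidiagonal] at hp
  have hpi : p.1 i + p.2 i = a i := by rw [← hp, Finsupp.add_apply]
  by_cases h1 : p.1 i = 0
  · rw [hG p.2 ⟨i, (le_max_right m n).trans hi, by omega⟩, mul_zero]
  · rw [hF p.1 ⟨i, (le_max_left m n).trans hi, h1⟩, zero_mul]

/-- Shrinking the radius keeps the weighted coefficient family summable. [folklore] -/
theorem summable_weighted_of_le {F : CSeries} {r r' : ℝ} (hr' : 0 ≤ r') (h : r' ≤ r)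
    (hs : Summable fun a : ℕ →₀ ℕ => ‖coeff a F‖ * r ^ degree a) :
    Summable fun a : ℕ →₀ ℕ => ‖coeff a F‖ * r' ^ degree a :=
  Summable.of_nonneg_of_le (fun a => by positivity) (fun a => by gcongr) hs

/-- **Polyradius `> 1` is stable under products** (Cauchy product:
`Σ_a ‖(FG)_a‖ ρ^{|a|} ≤ (Σ_b ‖F_b‖ ρ^{|b|})(Σ_c ‖G_c‖ ρ^{|c|})` with `ρ` the smaller radius).
[folklore] -/
theorem HasPolyradiusGtOne.mul {F G : CSeries} (hF : HasPolyradiusGtOne F)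
    (hG : HasPolyradiusGtOne G) : HasPolyradiusGtOne (F * G) := by
  obtain ⟨r, hr, hs⟩ := hF
  obtain ⟨r', hr', hs'⟩ := hG
  set ρ := min r r' with hρdef
  have hρ : 1 < ρ := lt_min hr hr'
  have hρ0 : 0 ≤ ρ := zero_le_one.trans hρ.le
  have hsF := summable_weighted_of_le hρ0 (min_le_left r r') hs
  have hsG := summable_weighted_of_le hρ0 (min_le_right r r') hs'
  refine ⟨ρ, hρ, ?_⟩
  set f : (ℕ →₀ ℕ) → ℝ := fun a => ‖coeff a F‖ * ρ ^ degree a with hfdef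
  set g : (ℕ →₀ ℕ) → ℝ := fun a => ‖coeff a G‖ * ρ ^ degree a with hgdef
  have hfn : Summable fun a => ‖f a‖ :=
    hsF.congr fun a => (Real.norm_of_nonneg (by positivity)).symm
  have hgn : Summable fun a => ‖g a‖ :=
    hsG.congr fun a => (Real.norm_of_nonneg (by positivity)).symm
  have hprod : Summable fun x : (ℕ →₀ ℕ) × (ℕ →₀ ℕ) => f x.1 * g x.2 :=
    summable_mul_of_summable_norm hfn hgn
  have hanti := summable_sum_mul_antidiagonal_of_summable_mul hprod
  refine Summable.of_nonneg_of_le (fun a => by positivity) (fun a => ?_) hanti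
  calc ‖coeff a (F * G)‖ * ρ ^ degree a
      = ‖∑ p ∈ Finset.HasAntidiagonal.antidiagonal a, coeff p.1 F * coeff p.2 G‖ * ρ ^ degree a := by
        rw [coeff_mul]
    _ ≤ (∑ p ∈ Finset.HasAntidiagonal.antidiagonal a, ‖coeff p.1 F‖ * ‖coeff p.2 G‖) * ρ ^ degree a := by
        gcongr
        exact (norm_sum_le _ _).trans (le_of_eq (Finset.sum_congr rfl fun p _ => norm_mul _ _))
    _ = ∑ p ∈ Finset.HasAntidiagonal.antidiagonal a, f p.1 * g p.2 := by
        rw [Finset.sum_mul]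
        refine Finset.sum_congr rfl fun p hp => ?_
        rw [Finset.HasAntidiagonal.mem_antidiagonal] at hp
        rw [hfdef, hgdef]
        simp only
        rw [← hp, map_add, pow_add]
        ring

/-- Polyradius `> 1` is stable under scalars. [folklore] -/
theorem HasPolyradiusGtOne.smul (c : ℂ) {F : CSeries} (h : HasPolyradiusGtOne F) :
    HasPolyradiusGtOne (c • F) := by
  obtain ⟨r, hr, hs⟩ := h
  refine ⟨r, hr, (hs.mul_left ‖c‖).congr fun a => ?_⟩
  rw [coeff_smul, norm_mul, mul_assoc]

/-- A variable involved in `F · G` is involved in `F` or in `G`. [folklore] -/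
theorem usesVar_mul {F G : CSeries} {i : ℕ} (h : UsesVar (F * G) i) : UsesVar F i ∨ UsesVar G i := by
  obtain ⟨a, hai, hne⟩ := h
  rw [coeff_mul] at hne
  obtain ⟨p, hp, hp0⟩ := Finset.exists_ne_zero_of_sum_ne_zero hne
  rw [Finset.HasAntidiagonal.mem_antidiagonal] at hp
  have hpi : p.1 i + p.2 i = a i := by rw [← hp, Finsupp.add_apply]
  by_cases h1 : p.1 i = 0
  · exact Or.inr ⟨p.2, by omega, right_ne_zero_of_mul hp0⟩
  · exact Or.inl ⟨p.1, h1, left_ne_zero_of_mul hp0⟩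

/-- A variable involved in `c • F` is involved in `F`. [folklore] -/
theorem usesVar_of_smul {c : ℂ} {F : CSeries} {i : ℕ} (h : UsesVar (c • F) i) : UsesVar F i := by
  obtain ⟨a, hai, hne⟩ := h
  exact ⟨a, hai, fun h0 => hne (by rw [coeff_smul, h0, mul_zero])⟩

section Closure

variable {k : Type} [Field k] (σ : k →+* ℂ)

/-- **`𝒪_{k-alg}(𝔻̄^∞)` is a ring: closed under products** (variables: union; polyradius: the
smaller one; algebraicity: `IsAlgebraic.mul` over the domain `k[z]`). This is the product of
`𝒫^{eff}(k, σ)` / the `𝒫^{eff}`-algebra structure of Notation 1.9 (ii).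
[cite: AyoubRelKZRevisited, Notation 1.9 (ii)] -/
theorem mul_mem_Oan {F G : CSeries} (hF : F ∈ Oan σ) (hG : G ∈ Oan σ) : F * G ∈ Oan σ := by
  obtain ⟨⟨m, hm⟩, hr, halg⟩ := hF
  obtain ⟨⟨n, hn⟩, hr', halg'⟩ := hG
  exact ⟨⟨max m n, hm.mul hn⟩, hr.mul hr', halg.mul σ halg'⟩

/-! ### `(2πi)^N` as an effective period in prescribed fresh variables -/

/-- `perGermPow m N = ∏_{j<N} (-8)/(α - z_{m+j})`. [folklore] -/
def perGermPow (m N : ℕ) : CSeries := ∏ j ∈ Finset.range N, (-8 : ℂ) • perGerm (m + j)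

omit [Field k] in
/-- Empty product: `perGermPow m 0 = 1`. [folklore] -/
@[simp] theorem perGermPow_zero (m : ℕ) : perGermPow m 0 = 1 := by
  simp [perGermPow]

omit [Field k] in
/-- `perGermPow m (N+1) = perGermPow m N · (-8)/(α - z_{m+N})`. [folklore] -/
theorem perGermPow_succ (m N : ℕ) :
    perGermPow m (N + 1) = perGermPow m N * ((-8 : ℂ) • perGerm (m + N)) :=
  Finset.prod_range_succ _ _

/-- `perGermPow m N ∈ 𝒪_{k-alg}(𝔻̄^∞)`. [cite: AyoubRelKZRevisited, Notation 1.9 (ii)] -/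
theorem perGermPow_mem_Oan (m N : ℕ) : perGermPow m N ∈ Oan σ := by
  induction N with
  | zero => rw [perGermPow_zero]; exact one_mem_Oan σ
  | succ N ih =>
    rw [perGermPow_succ]
    exact mul_mem_Oan σ ih (smul_mem_Oan σ (algebraic_neg_eight σ) (perGerm_mem_Oan σ _))

omit [Field k] in
/-- `perGermPow m N` involves only the variables `z_m, …, z_{m+N-1}`. [folklore] -/
theorem usesVar_perGermPow {m N i : ℕ} (h : UsesVar (perGermPow m N) i) : m ≤ i ∧ i < m + N := by
  induction N with
  | zero =>
    rw [perGermPow_zero] at h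
    exact absurd h (not_usesVar_one i)
  | succ N ih =>
    rw [perGermPow_succ] at h
    rcases usesVar_mul h with h | h
    · obtain ⟨h1, h2⟩ := ih h
      exact ⟨h1, by omega⟩
    · have := eq_of_usesVar_perGerm (usesVar_of_smul h)
      omega

omit [Field k] in
/-- **`∫ perGermPow m N = (2πi)^N`**: Fubini in disjoint variables (`intC_mul_of_disjoint`) and
`∫ (-8)/(α - z) = (-8) · (-iπ/4) = 2πi`. [cite: AyoubRelKZRevisited, Notation 1.9 (iii)] -/
theorem intC_perGermPow (m N : ℕ) : intC (perGermPow m N) = (2 * Real.pi * Complex.I) ^ N := by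
  induction N with
  | zero => rw [perGermPow_zero, intC_one, pow_zero]
  | succ N ih =>
    have hs1 := summable_norm_coeff_of_mem_Oan Complex.ofRealHom
      (perGermPow_mem_Oan Complex.ofRealHom m N)
    have hs2 := summable_norm_coeff_of_mem_Oan Complex.ofRealHom
      (smul_mem_Oan Complex.ofRealHom (algebraic_neg_eight Complex.ofRealHom)
        (perGerm_mem_Oan Complex.ofRealHom (m + N)))
    have hdisj : ∀ i, ¬ (UsesVar (perGermPow m N) i ∧ UsesVar ((-8 : ℂ) • perGerm (m + N)) i) := by
      rintro i ⟨h1, h2⟩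
      have h1' := usesVar_perGermPow h1
      have h2' := eq_of_usesVar_perGerm (usesVar_of_smul h2)
      omega
    rw [perGermPow_succ, intC_mul_of_disjoint hs1 hs2 hdisj, ih, intC_smul, intC_perGerm, pow_succ]
    push_cast
    ring

/-- **For every `N` and every finite set `S` of variables there is `g ∈ 𝒪_{k-alg}(𝔻̄^∞)` avoiding
`S` with `∫ g = (2πi)^N`** — the elements realising multiplication by `(2πi)^N` on classes
`[F]`, `F` in the variables `S`, in the Lean rendering of Théorème 1.11.
[cite: AyoubRelKZRevisited, Notation 1.9 (iii)] -/
theorem exists_mem_Oan_intC_eq_two_pi_I_pow (N : ℕ) (S : Finset ℕ) :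
    ∃ g ∈ Oan σ, (∀ i ∈ S, ¬ UsesVar g i) ∧ intC g = (2 * Real.pi * Complex.I) ^ N := by
  refine ⟨perGermPow (S.sup id + 1) N, perGermPow_mem_Oan σ _ _, fun i hi h => ?_,
    intC_perGermPow _ _⟩
  have h1 := (usesVar_perGermPow h).1
  have h2 : i ≤ S.sup id := Finset.le_sup (f := id) hi
  omega

/-- **`(2πi)^N ∈ 𝒫^{eff}(k, σ)`** for every `N`. [cite: AyoubRelKZRevisited, Notation 1.9 (iii)] -/
theorem two_pi_I_pow_mem_effPeriods (N : ℕ) : (2 * Real.pi * Complex.I) ^ N ∈ effPeriods σ :=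
  ⟨perGermPow 0 N, perGermPow_mem_Oan σ 0 N, intC_perGermPow 0 N⟩

/-- **Notation 1.9 (iii): `2πi ∈ 𝒫^{eff}(k, σ)`**, for every field `k` and every
`σ : k →+* ℂ` (witness: `∫₀¹ (-8) dz/(α - z)`, `α = 1/(1 - e^{iπ/4})`).
[cite: AyoubRelKZRevisited, Notation 1.9 (iii)] -/
theorem two_pi_I_mem_effPeriods : 2 * Real.pi * Complex.I ∈ effPeriods σ := by
  simpa using two_pi_I_pow_mem_effPeriods σ 1

end Closure

end Literature.NumberTheory.Transcendental.AyoubRel
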